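import Mathlib.Analysis.SpecialFunctions.Exp
import Literature.Probability.LatticeModels.CoarseCellMixingCounting
import HarnessLib

/-!
# Coarse-cell mixing with defects: annulus counts and the weighted-recursion arithmetic

Auxiliary ("theorems only") file for `CoarseCellMixingDefectsFloor.lean` (the Dobrushin–Shlosman
block recursion with a leak and Peierls-rare defects): the two cell counts and the one real
inequality of its weighted recursion that do not involve measures, isolated so that the recursion
file stays within size:

* `card_annulus_le` — the annulus `2n+1 ≤ cdist x c ≤ 2n+1+m` of the coarse `d`-torus has at most
  `(4n+3+2m)^d` cells; `card_annulus_zero_le_shellCount` — for `m = 0` at most `shellCount d n`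
  (on a torus with `≥ 4n+3` cells per side);
* `floor_annulus_term_le` — the `j`-th leak increment of the recursion, weight
  `Λl e^{-rj}` times `|Y_{j+1}| ≤ (4n+5+2j)^d` cells times (decay bound at the reduced radius plus
  floor) plus its bad-annulus term, is at most
  `2 Λl e^{r} (E·B + Φ + q) · (4n+5+2j)^d e^{-(r-κ)(j+1)}` with `E = e^{κ(2n+1)}`,
  `B = E e^{-κR}` (pure bookkeeping of exponents).

## References

* R. L. Dobrushin, S. B. Shlosman, *Constructive criterion for the uniqueness of Gibbs field*
  (1985), §2.
* H.-O. Georgii, *Gibbs Measures and Phase Transitions*, 2nd ed. (de Gruyter 2011), §8.1.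
-/

noncomputable section

namespace Literature.Probability.LatticeModels

variable {d : ℕ} {μc : Fin d → ℕ}

/-- **Annulus count**: at most `(4n+3+2m)^d` cells `c` of the coarse torus satisfy
`2n+1 ≤ cdist x c ≤ 2n+1+m` (they lie in the cube of radius `2n+1+m`). [folklore] -/
theorem card_annulus_le (x : CoarseIdx μc) (n m : ℕ) :
    ((Finset.univ.filter fun c : CoarseIdx μc =>
        2 * n + 1 ≤ cdist x c ∧ cdist x c ≤ 2 * n + 1 + m).card : ℝ) ≤
      ((4 * n + 3 + 2 * m) ^ d : ℕ) := by
  have h1 : (Finset.univ.filter fun c : CoarseIdx μc =>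
      2 * n + 1 ≤ cdist x c ∧ cdist x c ≤ 2 * n + 1 + m).card ≤
      (Finset.univ.filter fun c : CoarseIdx μc => cdist x c ≤ 2 * n + 1 + m).card :=
    Finset.card_le_card fun c hc => by
      rw [Finset.mem_filter] at hc
      exact Finset.mem_filter.2 ⟨Finset.mem_univ _, hc.2.2⟩
  have h2 := card_filter_cdist_le x (2 * n + 1 + m)
  have e : 2 * (2 * n + 1 + m) + 1 = 4 * n + 3 + 2 * m := by ring
  rw [e] at h2
  exact_mod_cast h1.trans h2

/-- **Shell count, annulus form**: on a coarse torus with `≥ 4n+3` cells per side, at most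
`shellCount d n` cells `c` satisfy `2n+1 ≤ cdist x c ≤ 2n+1+0`. [cite: DobrushinShlosman1985, §2] -/
theorem card_annulus_zero_le_shellCount (x : CoarseIdx μc) (n : ℕ)
    (hμ : ∀ i, 4 * n + 3 ≤ μc i + 1) :
    ((Finset.univ.filter fun c : CoarseIdx μc =>
        2 * n + 1 ≤ cdist x c ∧ cdist x c ≤ 2 * n + 1 + 0).card : ℝ) ≤ shellCount d n := by
  have h1 : (Finset.univ.filter fun c : CoarseIdx μc =>
      2 * n + 1 ≤ cdist x c ∧ cdist x c ≤ 2 * n + 1 + 0).card ≤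
      (Finset.univ.filter fun c : CoarseIdx μc => cdist x c = 2 * n + 1).card :=
    Finset.card_le_card fun c hc => by
      rw [Finset.mem_filter] at hc
      exact Finset.mem_filter.2 ⟨Finset.mem_univ _, by omega⟩
  exact_mod_cast h1.trans (card_shell_le_shellCount x n hμ)

/-- **The `j`-th annulus term of the weighted recursion with a floor.** For `0 ≤ κ ≤ r`,
`Λl, Φ, q ≥ 0`, `2n+1+(j+1) ≤ R` and a cell count `c ≤ (4n+5+2j)^d`:
`2 Λl e^{-rj} · c · (E e^{-κ(R-2n-2-j)} + Φ) + Λl e^{-rj} · 2 c q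
 ≤ 2 Λl e^{r} (E·B + Φ + q) · (4n+5+2j)^d e^{-(r-κ)(j+1)}` with `E = e^{κ(2n+1)}`,
`B = E e^{-κR}` (`e^{-rj} e^{-κ(R-2n-2-j)} = e^{r} B e^{-(r-κ)(j+1)}` and
`e^{-rj} ≤ e^{r} e^{-(r-κ)(j+1)}`). [folklore] -/
theorem floor_annulus_term_le {n R j : ℕ} {Λl r κ Φ q c : ℝ} (hΛl : 0 ≤ Λl) (hκ : 0 ≤ κ)
    (hΦ0 : 0 ≤ Φ) (hq : 0 ≤ q) (hj : 2 * n + 1 + (j + 1) ≤ R)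
    (hc : c ≤ ((4 * n + 5 + 2 * j) ^ d : ℝ)) :
    2 * (Λl * Real.exp (-(r * j))) * (c * (Real.exp (κ * (2 * n + 1)) *
        Real.exp (-(κ * ((R - (2 * n + 1) - (j + 1) : ℕ) : ℝ))) + Φ)) +
      (Λl * Real.exp (-(r * j))) * (2 * c * q) ≤
    2 * Λl * Real.exp r * (Real.exp (κ * (2 * n + 1)) * (Real.exp (κ * (2 * n + 1)) *
        Real.exp (-(κ * R))) + (Φ + q)) *
      (((4 * n + 5 + 2 * j) ^ d : ℝ) * Real.exp (-((r - κ) * (j + 1)))) := by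
  set E : ℝ := Real.exp (κ * (2 * n + 1)) with hE
  set B : ℝ := E * Real.exp (-(κ * R)) with hB
  have hcastj : ((R - (2 * n + 1) - (j + 1) : ℕ) : ℝ) = (R : ℝ) - (2 * n + 1) - (j + 1) := by
    rw [Nat.sub_sub, Nat.cast_sub hj]; push_cast; ring
  have hexp : Real.exp (-(r * j)) * Real.exp (-(κ * ((R - (2 * n + 1) - (j + 1) : ℕ) : ℝ))) =
      Real.exp r * B * Real.exp (-((r - κ) * (j + 1))) := by
    rw [hcastj, hB, hE, ← Real.exp_add, ← Real.exp_add, ← Real.exp_add, ← Real.exp_add]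
    congr 1; ring
  have hexp' : Real.exp (-(r * j)) ≤ Real.exp r * Real.exp (-((r - κ) * (j + 1))) := by
    rw [← Real.exp_add, Real.exp_le_exp]
    have hj0 : (0 : ℝ) ≤ j := Nat.cast_nonneg j
    nlinarith
  set w : ℝ := ((4 * n + 5 + 2 * j) ^ d : ℝ) * Real.exp (-((r - κ) * (j + 1))) with hw
  -- the decaying part
  have hA1 : 2 * (Λl * Real.exp (-(r * j))) * (c *
      (E * Real.exp (-(κ * ((R - (2 * n + 1) - (j + 1) : ℕ) : ℝ))))) ≤
      2 * Λl * Real.exp r * (E * B) * w := by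
    have hw0 : 0 ≤ Λl * Real.exp (-(r * j)) *
        (E * Real.exp (-(κ * ((R - (2 * n + 1) - (j + 1) : ℕ) : ℝ)))) := by positivity
    calc 2 * (Λl * Real.exp (-(r * j))) * (c *
          (E * Real.exp (-(κ * ((R - (2 * n + 1) - (j + 1) : ℕ) : ℝ)))))
        = 2 * c * (Λl * Real.exp (-(r * j)) *
            (E * Real.exp (-(κ * ((R - (2 * n + 1) - (j + 1) : ℕ) : ℝ))))) := by ring
      _ ≤ 2 * ((4 * n + 5 + 2 * j) ^ d : ℝ) * (Λl * Real.exp (-(r * j)) *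
            (E * Real.exp (-(κ * ((R - (2 * n + 1) - (j + 1) : ℕ) : ℝ))))) := by gcongr
      _ = 2 * Λl * E * ((4 * n + 5 + 2 * j) ^ d : ℝ) * (Real.exp (-(r * j)) *
            Real.exp (-(κ * ((R - (2 * n + 1) - (j + 1) : ℕ) : ℝ)))) := by ring
      _ = _ := by rw [hexp, hw]; ring
  -- the floor part
  have hA2 : 2 * (Λl * Real.exp (-(r * j))) * (c * Φ) +
      (Λl * Real.exp (-(r * j))) * (2 * c * q) ≤ 2 * Λl * Real.exp r * (Φ + q) * w := by
    have e : 2 * (Λl * Real.exp (-(r * j))) * (c * Φ) +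
        (Λl * Real.exp (-(r * j))) * (2 * c * q) =
        2 * Λl * (Φ + q) * (c * Real.exp (-(r * j))) := by ring
    rw [e]
    have hΦq : 0 ≤ 2 * Λl * (Φ + q) := by positivity
    calc 2 * Λl * (Φ + q) * (c * Real.exp (-(r * j)))
        ≤ 2 * Λl * (Φ + q) * (((4 * n + 5 + 2 * j) ^ d : ℝ) *
            (Real.exp r * Real.exp (-((r - κ) * (j + 1))))) :=
          mul_le_mul_of_nonneg_left (mul_le_mul hc hexp' (Real.exp_pos _).le
            (by positivity)) hΦq
      _ = _ := by rw [hw]; ring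
  have e3 : 2 * (Λl * Real.exp (-(r * j))) * (c *
      (E * Real.exp (-(κ * ((R - (2 * n + 1) - (j + 1) : ℕ) : ℝ))) + Φ)) +
      (Λl * Real.exp (-(r * j))) * (2 * c * q) =
      2 * (Λl * Real.exp (-(r * j))) * (c *
        (E * Real.exp (-(κ * ((R - (2 * n + 1) - (j + 1) : ℕ) : ℝ))))) +
      (2 * (Λl * Real.exp (-(r * j))) * (c * Φ) +
        (Λl * Real.exp (-(r * j))) * (2 * c * q)) := by ring
  rw [e3]
  calc _ ≤ 2 * Λl * Real.exp r * (E * B) * w + 2 * Λl * Real.exp r * (Φ + q) * w :=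
        add_le_add hA1 hA2
    _ = _ := by ring

end Literature.Probability.LatticeModels
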